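import Summits.Ventures.HSemireg.Pad4TowerSeedB1Odd
import Summits.Ventures.HSemireg.Pad4TowerPhaseTorus
import Summits.Ventures.HSemireg.Pad4TowerCleanCellOrbits

/-!
# Venture HSemireg — PAD-4 on 𝔅(μ₄): LINE 5 (iii) STATIC-LEMMA SIGNATURE (T′-a), TORUS HALF — the phase torus `T = (ℤ∕4)⁴` on
# two-level supports, «every static family of record is `T`-invariant» in HYPOTHESIS FORM ((σ-T), (σ-T′); (σ-T′) ⇒ (σ-T) and the
# ◇ₕ conjunct PROVED), and the Δ-only weakening of (B1-odd) REFUTED as a proved implication from (σ-T) + ONE named machine support ((σ-N))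

HONEST FRAMING. Lean index of the computation cell `pub-hsemireg` (S4-PUSH, H2 door PAD-4), typed by the Ventures-side typer
`hodge-lit-semireg-typer-2` (g6; line of record stmt-HodgeConjecture-18881 `Cruxes/BlochSeedDiscOne/Lines/birth.lean` 814a6a70c14e831a,
stub `stub_rung_pad4_seedAt`). Sequel of (T) `Pad4TowerSeedB1Odd`; sibling `Pad4TowerSeedFCUnit` ((σ-R), `LocalKill`, the seeds (W) ∕ (W′)
and their case assemblies — the other half of (T′-a), split off only because Theorems files with proofs are ≤ 400 lines). WHAT THIS FILE IS:
the SIGNATURE half (a) of LINE 5 (iii)'s static lemma (director-hodge g14 R14.12: bc5-plan g8 drafts the signature, gs-eng-2 g53 AGREE ∕ AMEND,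
typer-2 types; R14.15 (2), R14.23 (2): (T′-a) proceeds, (T′-b) — the Lean replay of the peel — CANCELLED). BYTES OF RECORD: bc5-plan g8's
`SketchStaticTorus.lean` v3.2 47a52d8ed73fcbfe (cell `hodge-bloch-bc5-plan∕work∕g8∕lean∕`; v1 6c2ce51e70a3ee88 = the signature ACCEPTED AS THE
AGREED SHAPE, R14.15, cell INBOX l.32699; v2 = + (σ-N)) — definitions and proof bodies VERBATIM from the sketch; module text, docstrings,
probe names and the ◇ₕ lemmas by the typer. Pencil of record: gs-eng-2 g53 `general-structure∕PENCIL-B1ODD-gs2g53.md` v0.1 efb274008ca24bf4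
§1 LEMMA T (torus blindness).

STATUS WORDS. HYPOTHESIS-FORM defs (`def … : Prop`, NOT asserted, no `axiom`, no `sorry`, no proof here): **(σ-T) `StaticFamiliesTorusInvariant`**
and **(σ-T′) `StaticFamiliesTorusInvariantFamilywise`** — MACHINE: g53 `valtorus.py` e722d0a6597da841, 300 random instance-centred 𝔅(μ₄) supports
× 6 families under single-factor rotation, 0 failures; structural PENCIL §1: every static predicate is a first-order combination of per-factor
primitives whose direction variables live on ONE factor and are quantified inside, re-indexed `k ↦ k − 1` by a rotation, metric data (`|β|²`,
`α`) invariant, cross-factor comparisons between coordinate VALUES only; the kernel proof — one covariance lemma per primitive (`ray`, `coord`,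
`Adapted`, `DirOK`, `EncDir`, `UPartner`, `Sibling`, `NullBelow`, `bsub`, `cabs`), then `Finset.image` bookkeeping — is NOT here for the five
static families (routine but long; RULE-D has the most binders); **`StaticDeltaSupportWithRealFC`** — a named MACHINE support (the ◇₈-`G₁` no-Ψ
survivor of kit j298438, `j298438-D8-witness-D8-no_psi-kissat.json` 8d3ee082b6d8b019: 14 `G₁`-orbits = 137 N + 181 P cells, static-clean,
containing `P[(6I+ℓ)⁴]` whose `Δ`-cycle holds the all-real cell `P[6I+ℓ₁]⁴`; a `decide` of `RuleDMu4Closed` on ≈ 318 cells — ~10⁸ elementary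
checks — is not attempted, bc5-plan g8 l.32702); `SeedB1OddDiamond8DeltaH1` — the Δ-only weakening of (T), typed to be REFUTED, not claimed.
**PROVED**: the ◇ₕ conjunct of (σ-T′) **`MConfig.inDiamond_phaseImage_iff`** (every `η`, every `h`; `Δ` keeps nodes, axis letters, `α` and
`|charge|`); `staticFamiliesTorusInvariant_of_familywise` ((σ-T′) ⇒ (σ-T)); **(σ-N) `not_seedB1OddDiamond8DeltaH1_of`**: (σ-T) ∧
`StaticDeltaSupportWithRealFC` ⇒ ¬ `SeedB1OddDiamond8DeltaH1` — one factor rotation `η = (0,0,0,1)` turns a real-phase FC class into an odd one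
while (σ-T) keeps ◇₈ and `StaticH1` and the abelian torus keeps Δ-closure; READING (R14.15 (i)): `S₄`-closure is LOAD-BEARING in
`SeedB1OddDiamond8G1H1` at every odd class — a proof of (T) that never permutes factors is impossible (PENCIL §1 (d)).

CONTENT. §1 `MConfig.phaseImage` (+ `_lower ∕ _upper`; `phaseImage_dVec_of_deltaClosed`: `phaseImage dVec` is the identity on Δ-closed supports —
Δ is central, so Δ-closure is torus-compatible and only the `S₄` half of `G₁` is not), `inDiamond_deltaPt_iff` ∕ `_iterate_iff` ∕
`MCell.inDiamond_phase_iff` ∕ `MConfig.inDiamond_phaseImage_iff` (PROVED), (σ-T), (σ-T′), `staticFamiliesTorusInvariant_of_familywise`.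
§2 (σ-N): `SeedB1OddDiamond8DeltaH1`, the generic rotation lemmas `MCell.delta_phase`, `deltaClosed_image_phase`, `snd_deltaPt_ne` ∕ `_iterate_ne`,
`MCell.fcc_phase`, `MCell.pat_phase_last`, `MConfig.hasOddFC_phaseImage_of_hasFC_zero` (PROVED), `StaticDeltaSupportWithRealFC`,
`not_seedB1OddDiamond8DeltaH1_of` (PROVED). §3 probes (`decide`): one factor rotation flips parity weight odd ↔ even; `phaseImage` computes.
USES of (σ-T) (bc5-plan l.32697): (i) the NO-GO (σ-N); (ii) TRANSPORT of a local kill (`Pad4TowerSeedFCUnit.LocalKill`) proved at ONE phase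
normalisation to all its `η`-rotates. It proves NEITHER (S) nor (T) by itself.

WHAT IS NOT HERE ∕ NOT IN LEAN. No proof of (σ-T) ∕ (σ-T′) beyond the ◇ₕ conjunct; no witness support entered for `StaticDeltaSupportWithRealFC`;
no case list, no proof of (T) ∕ (S) ∕ (W) ∕ (W′) ((T′-b) cancelled, R14.23 (2)); no (B2) ∕ r3, no `G′` form. NOTHING HERE SAYS THAT (S) ∕ (T) ∕
(W) ∕ (W′) ∕ H2 ∕ HC ∕ HC_CM ∕ HC_AV ∕ W₆ ∕ HC_Kum4Type HOLDS OR FAILS; typed ≠ proved ≠ endorsed; machine ≠ kernel. No `instance`, no notation,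
no attribute, no Literature fact, 0 `sorry`; axioms standard.
-/

namespace Summit.Ventures.HSemireg.Pad4Tower

open Finset

/-! ## §1 The phase image of a support; (σ-T) and (σ-T′) in hypothesis form; (σ-T′) ⇒ (σ-T) -/

/-- the image of a two-level support under the factorwise phase rotation `η ∈ T = (ℤ∕4)⁴` (`MCell.phase`, file `Pad4TowerPhaseTorus`:
`(η·Z)_f = rot^{η_f}(Z_f)`, `rot(α, β) = (α, iβ)`): both levels rotated, level structure kept. [bc5-plan g8 sketch v2 638c407a2de29eb1] -/
def MConfig.phaseImage (η : PVec) (C : MConfig) : MConfig :=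
  ⟨C.lower.image (MCell.phase η), C.upper.image (MCell.phase η)⟩

/-- the lower level of the phase image is the image of the lower level. [rfl] -/
theorem MConfig.phaseImage_lower (η : PVec) (C : MConfig) : (C.phaseImage η).lower = C.lower.image (MCell.phase η) := rfl

/-- the upper level of the phase image is the image of the upper level. [rfl] -/
theorem MConfig.phaseImage_upper (η : PVec) (C : MConfig) : (C.phaseImage η).upper = C.upper.image (MCell.phase η) := rfl

/-- `phaseImage` by `dVec = (1,1,1,1)` is the `Δ`-image, so a support with `Δ`-closed levels is fixed by it (`MCell.phase_dVec`, `image_delta_eq`):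
`Δ` is central in the torus, hence `Δ`-closure is torus-compatible — only the `S₄` half of `G₁` is not. -/
theorem MConfig.phaseImage_dVec_of_deltaClosed (C : MConfig) (hl : DeltaClosed C.lower) (hu : DeltaClosed C.upper) :
    C.phaseImage dVec = C := by
  have h1 : C.lower.image (MCell.phase dVec) = C.lower := by
    rw [show MCell.phase dVec = MCell.delta from funext MCell.phase_dVec]; exact image_delta_eq _ hl
  have h2 : C.upper.image (MCell.phase dVec) = C.upper := by
    rw [show MCell.phase dVec = MCell.delta from funext MCell.phase_dVec]; exact image_delta_eq _ hu
  cases C; simp only [MConfig.phaseImage] at *; rw [h1, h2]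

/-- `Δ` (`deltaPt`: `β ↦ iβ`) keeps the diamond predicate letter by letter: a letter of ◇ₕ is a node (fixed) or an axis letter (kept an axis letter,
`α` kept, charge `|chargeOf|` kept); a non-axis letter with `β ≠ 0` is outside ◇ₕ before and after. [case split on `Re β = 0`, `Im β = 0`; `simp`] -/
theorem inDiamond_deltaPt_iff (h : ℤ) (x : BPoint) : InDiamond h (deltaPt x) ↔ InDiamond h x := by
  obtain ⟨a, b, c⟩ := x
  by_cases hb : b = 0
  · subst hb
    by_cases hc : c = 0
    · subst hc; simp [InDiamond, AxisPt, absCharge, chargeOf, deltaPt]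
    · simp [InDiamond, AxisPt, absCharge, chargeOf, deltaPt, hc, abs_neg]
  · by_cases hc : c = 0
    · subst hc; simp [InDiamond, AxisPt, absCharge, chargeOf, deltaPt, hb, abs_neg]
    · simp [InDiamond, AxisPt, absCharge, chargeOf, deltaPt, hb, hc]

/-- … hence so does every iterate of `Δ` … -/
theorem inDiamond_deltaPt_iterate_iff (h : ℤ) (n : ℕ) : ∀ x : BPoint, InDiamond h (deltaPt^[n] x) ↔ InDiamond h x := by
  induction n with
  | zero => intro x; simp
  | succ n ih => intro x; rw [Function.iterate_succ_apply', inDiamond_deltaPt_iff, ih]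

/-- … hence every phase rotation keeps «the cell lies in ◇ₕ» (`phasePt_eq_iterate`). -/
theorem MCell.inDiamond_phase_iff (η : PVec) (h : ℤ) (Z : MCell) : (Z.phase η).InDiamond h ↔ Z.InDiamond h :=
  forall_congr' fun f => by
    show Pad4Tower.InDiamond h (phasePt (η f) (Z f)) ↔ Pad4Tower.InDiamond h (Z f)
    rw [phasePt_eq_iterate, inDiamond_deltaPt_iterate_iff]

/-- **the ◇ₕ conjunct of (σ-T′), PROVED**: the phase image of a support lies in ◇ₕ iff the support does (every `η ∈ (ℤ∕4)⁴`, every `h`). -/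
theorem MConfig.inDiamond_phaseImage_iff (η : PVec) (h : ℤ) (C : MConfig) : (C.phaseImage η).InDiamond h ↔ C.InDiamond h := by
  constructor
  · rintro ⟨hl, hu⟩
    exact ⟨fun Z hZ => (Z.inDiamond_phase_iff η h).mp (hl _ (by rw [MConfig.phaseImage_lower]; exact Finset.mem_image_of_mem _ hZ)),
      fun P hP => (P.inDiamond_phase_iff η h).mp (hu _ (by rw [MConfig.phaseImage_upper]; exact Finset.mem_image_of_mem _ hP))⟩
  · rintro ⟨hl, hu⟩
    refine ⟨fun Z hZ => ?_, fun P hP => ?_⟩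
    · rw [MConfig.phaseImage_lower] at hZ
      obtain ⟨W, hW, rfl⟩ := Finset.mem_image.mp hZ
      exact (W.inDiamond_phase_iff η h).mpr (hl W hW)
    · rw [MConfig.phaseImage_upper] at hP
      obtain ⟨W, hW, rfl⟩ := Finset.mem_image.mp hP
      exact (W.inDiamond_phase_iff η h).mpr (hu W hW)

/-- **(σ-T) `StaticFamiliesTorusInvariant` — LEMMA T (torus blindness of the static game), BUNDLE FORM; HYPOTHESIS FORM, NOT asserted.** For every
`η ∈ (ℤ∕4)⁴` (partial moves included: no `DetOne`, no cleanness) and every two-level support `C` in ◇ₕ (GUARD: g53's `valtorus.py` 300∕300 ran on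
𝔅(μ₄) supports; the unguarded family-wise form is (σ-T′)): the rotated support stays in ◇ₕ and `StaticH1 = RuleDMu4Closed ∧ XPlusClosed ∧ A2IMinusClosed`
holds on it iff it holds on `C`. Evidence MACHINE + PENCIL (module docstring); proves NEITHER (S) nor (T) by itself; uses: (σ-N), `LocalKill` transport. -/
def StaticFamiliesTorusInvariant : Prop :=
  ∀ (η : PVec) (C : MConfig) (h : ℤ), C.InDiamond h → (C.phaseImage η).InDiamond h ∧ ((C.phaseImage η).StaticH1 ↔ C.StaticH1)

/-- **(σ-T′) `StaticFamiliesTorusInvariantFamilywise` — the FAMILY-WISE, UNGUARDED form; HYPOTHESIS FORM, NOT asserted** (what `valtorus.py`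
checked 300∕300 per family, X⁻ and A2I⁺ included): `RuleDMu4Closed`, `XMinusClosed`, `XPlusClosed`, `A2IMinusClosed`, `A2IPlusClosed` and every
`InDiamond h` are separately invariant under every `η ∈ (ℤ∕4)⁴`, over all of `ℤ³`. Implies (σ-T); its ◇ₕ conjunct is PROVED above. -/
def StaticFamiliesTorusInvariantFamilywise : Prop :=
  ∀ (η : PVec) (C : MConfig),
    (RuleDMu4Closed (C.phaseImage η) ↔ RuleDMu4Closed C) ∧ (XMinusClosed (C.phaseImage η) ↔ XMinusClosed C) ∧
    (XPlusClosed (C.phaseImage η) ↔ XPlusClosed C) ∧ (A2IMinusClosed (C.phaseImage η) ↔ A2IMinusClosed C) ∧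
    (A2IPlusClosed (C.phaseImage η) ↔ A2IPlusClosed C) ∧ ∀ h : ℤ, (C.phaseImage η).InDiamond h ↔ C.InDiamond h

/-- (σ-T′) ⇒ (σ-T): the bundle form follows from the family-wise form by projection. [bc5-plan g8 sketch, verbatim] -/
theorem staticFamiliesTorusInvariant_of_familywise (h : StaticFamiliesTorusInvariantFamilywise) : StaticFamiliesTorusInvariant :=
  fun η C d hd => ⟨((h η C).2.2.2.2.2 d).mpr hd, ⟨fun hs => ⟨(h η C).1.mp hs.1, (h η C).2.2.1.mp hs.2.1, (h η C).2.2.2.1.mp hs.2.2⟩,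
    fun hs => ⟨(h η C).1.mpr hs.1, (h η C).2.2.1.mpr hs.2.1, (h η C).2.2.2.1.mpr hs.2.2⟩⟩⟩

/-! ## §2 (σ-N) what (σ-T) forbids: the Δ-only weakening of (B1-odd) is refuted by (σ-T) + ONE static Δ-closed ◇₈ support with a real-phase FC class -/

/-- **`SeedB1OddDiamond8DeltaH1` — the `Δ`-ONLY WEAKENING of (T)** (`G1Closed` replaced by `Δ`-closure of both levels; typed in order to be REFUTED,
NOT asserted, not claimed): it is FALSE as soon as ONE `H₁`-static `Δ`-closed ◇₈ support carries ANY FC class (the 14 static-clean survivors of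
j298438 carry the even ceiling cells `P[6I+ℓ_u]⁴`; rotating one factor by `η = (0,0,0,1)` keeps `StaticH1`, `Δ`-closure and ◇₈ by (σ-T) and makes that
cell odd) — `not_seedB1OddDiamond8DeltaH1_of`. READING (R14.15 (i)): `S₄`-closure is LOAD-BEARING in `SeedB1OddDiamond8G1H1` at every odd class;
a proof of (T) that never permutes factors is impossible (PENCIL §1 (d)). -/
def SeedB1OddDiamond8DeltaH1 : Prop :=
  ∀ C : MConfig, C.InDiamond 8 → DeltaClosed C.lower → DeltaClosed C.upper → C.StaticH1 → ¬ C.HasOddFC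

/-- `Δ` commutes with every phase rotation (the torus is abelian and `Δ = phase dVec`: `MCell.phase_dVec`, `MCell.phase_add`). -/
theorem MCell.delta_phase (η : PVec) (Z : MCell) : (Z.phase η).delta = Z.delta.phase η := by
  rw [← MCell.phase_dVec, ← MCell.phase_dVec, ← MCell.phase_add, ← MCell.phase_add, add_comm]

/-- the phase image of a `Δ`-closed level is `Δ`-closed. [`MCell.delta_phase`] -/
theorem deltaClosed_image_phase (η : PVec) {S : Finset MCell} (hS : DeltaClosed S) : DeltaClosed (S.image (MCell.phase η)) := by
  intro Z hZ
  obtain ⟨W, hW, rfl⟩ := Finset.mem_image.mp hZ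
  exact Finset.mem_image.mpr ⟨W.delta, hS W hW, (MCell.delta_phase η W).symm⟩

/-- `β ↦ iβ` (`deltaPt`) keeps `β ≠ 0` … -/
theorem snd_deltaPt_ne {x : BPoint} (hx : x.2 ≠ (0, 0)) : (deltaPt x).2 ≠ (0, 0) := fun h => by
  have h1 : -x.2.2 = 0 := congrArg Prod.fst h
  have h2 : x.2.1 = 0 := congrArg Prod.snd h
  exact hx (Prod.ext h2 (by simpa using h1))

/-- … so does every iterate of `deltaPt` … -/
theorem snd_deltaPt_iterate_ne (n : ℕ) : ∀ {x : BPoint}, x.2 ≠ (0, 0) → (deltaPt^[n] x).2 ≠ (0, 0) := by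
  induction n with
  | zero => intro x hx; simpa using hx
  | succ n ih => intro x hx; rw [Function.iterate_succ_apply']; exact snd_deltaPt_ne (ih hx)

/-- … hence phase rotations keep full charge (`phasePt_eq_iterate`). -/
theorem MCell.fcc_phase (η : PVec) {Z : MCell} (hZ : FCc Z) : FCc (Z.phase η) := fun f => by
  show (phasePt (η f) (Z f)).2 ≠ (0, 0)
  rw [phasePt_eq_iterate]
  exact snd_deltaPt_iterate_ne _ (hZ f)

/-- rotating the LAST factor of a real-phase (pattern `0000`) FC axis cell once gives the odd pattern `0001` (`kbit_deltaPt`: `Δ` flips the phase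
bit of an axis letter; `pat_eq_of_bitOf`). -/
theorem MCell.pat_phase_last (Z : MCell) (hax : AxisCell Z) (h0 : Z.pat = 0) : (Z.phase (pv 0 0 0 1)).pat = 1 := by
  have hb := bitOf_pat Z
  have hb' := bitOf_pat (Z.phase (pv 0 0 0 1))
  rw [h0] at hb
  have k0 : kbit (Z 0) = 0 := by rw [← hb 0]; decide
  have k1 : kbit (Z 1) = 0 := by rw [← hb 1]; decide
  have k2 : kbit (Z 2) = 0 := by rw [← hb 2]; decide
  have k3 : kbit (Z 3) = 0 := by rw [← hb 3]; decide
  have e0 : (Z.phase (pv 0 0 0 1)) 0 = Z 0 := rfl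
  have e1 : (Z.phase (pv 0 0 0 1)) 1 = Z 1 := rfl
  have e2 : (Z.phase (pv 0 0 0 1)) 2 = Z 2 := rfl
  have e3 : (Z.phase (pv 0 0 0 1)) 3 = deltaPt (Z 3) := rfl
  apply pat_eq_of_bitOf
  · rw [hb', e0, k0]; decide
  · rw [hb', e1, k1]; decide
  · rw [hb', e2, k2]; decide
  · rw [hb', e3, kbit_deltaPt _ (hax 3), k3]; decide

/-- on a support in ◇₈ carrying a real-phase FC class (`HasFC 0`, pattern `0000`), the single-factor rotation `η = (0,0,0,1)` produces an ODD FC class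
(`MCell.pat_phase_last`, `MCell.fcc_phase`; axis cells from ◇₈). -/
theorem MConfig.hasOddFC_phaseImage_of_hasFC_zero {C : MConfig} (hU : C.InDiamond 8) (h0 : C.HasFC 0) :
    (C.phaseImage (pv 0 0 0 1)).HasOddFC := by
  obtain ⟨Z, hZ, hfc, hp⟩ := h0
  have hax : AxisCell Z := by
    rcases hZ with hZ | hZ
    · exact (MConfig.axisCell_of_inDiamond hU).1 Z hZ hfc
    · exact (MConfig.axisCell_of_inDiamond hU).2 Z hZ hfc
  have hodd : OddPat (Z.phase (pv 0 0 0 1)).pat := by rw [Z.pat_phase_last hax hp]; exact Or.inl rfl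
  rcases hZ with hZ | hZ
  · exact Or.inl ⟨Z.phase _, by rw [MConfig.phaseImage_lower]; exact Finset.mem_image_of_mem _ hZ, MCell.fcc_phase _ hfc, hodd⟩
  · exact Or.inr ⟨Z.phase _, by rw [MConfig.phaseImage_upper]; exact Finset.mem_image_of_mem _ hZ, MCell.fcc_phase _ hfc, hodd⟩

/-- **`StaticDeltaSupportWithRealFC` — the MACHINE FACT the negative needs, as a NAMED HYPOTHESIS (HYPOTHESIS FORM, NOT asserted):** some
`H₁`-static two-level support in ◇₈ with both levels `Δ`-closed carries a fully charged class of the real pattern `0000`. Instance of record: the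
◇₈-`G₁` no-Ψ survivor of kit j298438 (8d3ee082b6d8b019; each of the 14 static-clean survivors would do); entering one is a `decide` of
`RuleDMu4Closed` on ≈ 318 cells — not attempted in this tree (bc5-plan g8, cell INBOX l.32702). -/
def StaticDeltaSupportWithRealFC : Prop :=
  ∃ C : MConfig, C.InDiamond 8 ∧ DeltaClosed C.lower ∧ DeltaClosed C.upper ∧ C.StaticH1 ∧ C.HasFC 0

/-- **(σ-N) PROVED AS AN IMPLICATION: torus invariance (σ-T) + one such support REFUTE the `Δ`-only weakening of (T)** — so `S₄`-closure is
load-bearing in `SeedB1OddDiamond8G1H1`. [rotate the last factor by `η = (0,0,0,1)`: ◇₈ and `StaticH1` kept by (σ-T), `Δ`-closure kept because the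
torus is abelian (`deltaClosed_image_phase`), the `0000` class becomes a `0001` class (`hasOddFC_phaseImage_of_hasFC_zero`). bc5-plan g8 sketch v2,
verbatim.] -/
theorem not_seedB1OddDiamond8DeltaH1_of (hT : StaticFamiliesTorusInvariant) (hW : StaticDeltaSupportWithRealFC) :
    ¬ SeedB1OddDiamond8DeltaH1 := by
  intro hseed
  obtain ⟨C, hU, hdl, hdu, hS, h0⟩ := hW
  obtain ⟨hU', hS'⟩ := hT (pv 0 0 0 1) C 8 hU
  exact hseed _ hU' (deltaClosed_image_phase _ hdl) (deltaClosed_image_phase _ hdu) (hS'.mpr hS)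
    (MConfig.hasOddFC_phaseImage_of_hasFC_zero hU h0)

/-! ## §3 Probes (`decide`; the new definitions compute — NOT evidence about any support of record) -/

section Probes

/-- one factor rotation flips the parity weight odd ↔ even: the odd floor cell `[ℓ₁|ℓ₁|ℓ₁|ℓ_i]` (pattern `0001`) rotated once more in factor `3`
is EVEN; the even floor cell `[ℓ₁]⁴` (pattern `0000`) rotated once in factor `0` is ODD. [kernel, `decide`] -/
theorem oddPat_phase_probe : OddPat (mcellOf (lpt 1 0) (lpt 1 0) (lpt 1 0) (lpt 1 1)).pat ∧
    ¬ OddPat ((mcellOf (lpt 1 0) (lpt 1 0) (lpt 1 0) (lpt 1 1)).phase (pv 0 0 0 1)).pat ∧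
    OddPat ((mcellOf (lpt 1 0) (lpt 1 0) (lpt 1 0) (lpt 1 0)).phase (pv 1 0 0 0)).pat := by decide

/-- the phase image computes: rotating factor `3` of (T)'s one-cell probe support `oddFloorCfg = {N[ℓ₁|ℓ₁|ℓ₁|ℓ_i]}` by `η = (0,0,0,1)` gives the
one-cell support on the diagonal cell `N[ℓ₁]⁴` (level `P` stays empty), and rotating by `η = (0,0,0,3)` afterwards returns the original level
(`(ℤ∕4)⁴` acts). [kernel, `decide`] -/
theorem phaseImage_probe : (oddFloorCfg.phaseImage (pv 0 0 0 1)).lower = {mcellOf (lpt 1 0) (lpt 1 0) (lpt 1 0) (lpt 1 0)} ∧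
    (oddFloorCfg.phaseImage (pv 0 0 0 1)).upper = ∅ ∧
    ((oddFloorCfg.phaseImage (pv 0 0 0 1)).phaseImage (pv 0 0 0 3)).lower = oddFloorCfg.lower := by decide

end Probes

end Summit.Ventures.HSemireg.Pad4Tower
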